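import Mathlib
import Literature.Analysis.FluidPDE.VectorCalculus
import Literature.Analysis.FluidPDE.TaoAveragedNondegeneracy
import Summits.NavierStokesRegularity.NavierStokesRegularity.Theorems.FilamentSkeletonRssSkeletonEquilibriumKernelIntegrable

/-!
# Route `FilamentSkeletonRss` · crux `SkeletonJ1R` (stmt-NavierStokesRegularity-23610) · stub D `FlatOutputL` — TOOLS I: the TANGENTIAL component
# of the regularised SELF-INDUCTION along a near-straight filament is `O(κ₀)`, uniformly along the arm (no logarithm)

The one analytic input of the bookkeeping stub D (`FlatOutputL`, registered line `streamline_kantorovich_R`, shelf line `lia_switchoff_degree_R`):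
off the crux ball the TRUE slip `w = ⟪u_X(X_jτ) + ½X_jτ − αe₃×X_jτ, X_j′τ⟫` must not vanish, so the tangential component of the regularised
Biot–Savart velocity along the filament must be `O(√Γ)` UNIFORMLY IN `τ` (the drift grows like `|τ|/8`).  This file (core parameter `e ≠ 0`
arbitrary): §1 near-straight geometry of a unit-speed curve with tangent oscillation `≤ ε` (aligned tangents, chords project on EVERY tangent, GLOBAL
chord–arc, chord `ε|u−t|`-close to `(u−t)X′s`, second-order Taylor remainder from a curvature bound); §2 SELF STRAND: with `‖X″‖ ≤ κ₀` and
chord–arc constant `c ∈ (0,1]` the tangential part of the self-induction integrand is pointwise `≤ (2κ₀²/c³)(1 + κ₀²(σ−τ)²)⁻¹` — the identity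
`⟪X′σ × (Xτ−Xσ), X′τ⟫ = ⟪(X′σ − X′τ) × (Xτ−Xσ+(σ−τ)X′τ), X′τ⟫` (first- × second-order Taylor remainders) against the kernel `≤ ‖Xτ−Xσ‖⁻³`,
and `‖Xτ−Xσ‖⁻²` far out — whence `|⟪∫ K • X′σ × (Xτ−Xσ) dσ, X′τ⟫| ≤ 2πκ₀/c³` (`abs_inner_selfInduction_le`): the log-large binormal
(local-induction) part of the self-induced velocity is orthogonal to the tangent.  Companion `…SkeletonJ1RFarTools` does the other strands.
Reused by name: `stub_kernelIntegrable` (landed `…SkeletonEquilibriumKernelIntegrable`).  Three 10-line tools (`abs_triple_le`, `norm_deriv_sub_deriv_le`,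
`pos_sub_eq_integral` of the landed `…SkeletonEquilibriumTameVerticalToolsB` / `…LocalChordArcTools`) are carried as PRIVATE adapted copies because the
hub holds no `.olean` for those two modules (gate build backlog, 2026-08-29) — to be re-imported by name once they are built.
HONEST FRAMING: MODEL rung, ∃-side tools about a HYPOTHETICAL filament-type blow-up skeleton; elementary real analysis; nothing here bears on
Navier–Stokes regularity, which is NOT proved. [folklore]
-/

-- `dupNamespace` off: the module name repeats `NavierStokesRegularity` by the tree's `Summits/<S>/<S>/Theorems` layout (same as every sibling file).
set_option linter.dupNamespace false

noncomputable section

namespace Summit.NavierStokesRegularity.NavierStokesRegularity.Theorems.SkeletonJ1RSlipTools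

open MeasureTheory Filter Topology intervalIntegral
open Literature.Analysis.FluidPDE Literature.Analysis.FluidPDE.Tao2016
open Summit.NavierStokesRegularity.NavierStokesRegularity.Theorems.SkeletonEquilibrium.Sketch (stub_kernelIntegrable)
open scoped RealInnerProductSpace InnerProductSpace BigOperators

/-! ## §0 Three small tools (private adapted copies, see the module docstring) -/

/-- Hadamard: `|⟪u × v, w⟫| ≤ ‖u‖ ‖v‖ ‖w‖`. [folklore] -/
private theorem sjt_abs_triple_le (u v w : EuclideanSpace ℝ (Fin 3)) : |⟪cross u v, w⟫| ≤ ‖u‖ * ‖v‖ * ‖w‖ := by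
  -- adapted from FilamentSkeletonRssSkeletonEquilibriumTameVerticalToolsB (abs_triple_le)
  have h1 := abs_real_inner_le_norm (cross u v) w
  have h2 : ‖cross u v‖ ≤ ‖u‖ * ‖v‖ := by
    rw [norm_cross]
    have : Real.sin (InnerProductGeometry.angle u v) ≤ 1 := Real.sin_le_one _
    have : 0 ≤ ‖u‖ * ‖v‖ := by positivity
    nlinarith
  calc |⟪cross u v, w⟫| ≤ ‖cross u v‖ * ‖w‖ := h1
    _ ≤ ‖u‖ * ‖v‖ * ‖w‖ := by gcongr

/-- Tangent turning: `‖X′(u) − X′(t)‖ ≤ κ₀ |u − t|` when `‖X″‖ ≤ κ₀`. [folklore] -/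
private theorem sjt_norm_deriv_sub_deriv_le {E : Type*} [NormedAddCommGroup E] [NormedSpace ℝ E] {X : ℝ → E}
    (hX : ContDiff ℝ 2 X) {κ₀ : ℝ} (hκ : ∀ s, ‖deriv (deriv X) s‖ ≤ κ₀) (u t : ℝ) :
    ‖deriv X u - deriv X t‖ ≤ κ₀ * |u - t| := by
  -- adapted from FilamentSkeletonRssSkeletonEquilibriumLocalChordArcTools (norm_deriv_sub_deriv_le)
  have hd : Differentiable ℝ (deriv X) := hX.differentiable_deriv_two
  have := Convex.norm_image_sub_le_of_norm_deriv_le (s := Set.univ) (fun x _ => hd x)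
    (fun x _ => hκ x) convex_univ (Set.mem_univ t) (Set.mem_univ u)
  rw [← Real.norm_eq_abs]; simpa [norm_sub_rev] using this

/-- FTC for the position: `X(τ₀+s) − X(τ₀) − s • X′(τ₀) = ∫₀ˢ (X′(τ₀+u) − X′(τ₀)) du`. [folklore] -/
private theorem sjt_pos_sub_eq_integral {E : Type*} [NormedAddCommGroup E] [NormedSpace ℝ E] [CompleteSpace E]
    {X : ℝ → E} (hX : ContDiff ℝ 2 X) (τ₀ s : ℝ) :
    X (τ₀ + s) - X τ₀ - s • deriv X τ₀ = ∫ u in (0:ℝ)..s, (deriv X (τ₀ + u) - deriv X τ₀) := by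
  -- adapted from FilamentSkeletonRssSkeletonEquilibriumTameVerticalToolsB (pos_sub_eq_integral)
  have hd : Differentiable ℝ X := hX.differentiable (by norm_num)
  have hc : Continuous (deriv X) := hX.continuous_deriv (by norm_num)
  have I1 : IntervalIntegrable (fun u => deriv X (τ₀ + u)) volume 0 s :=
    (hc.comp (continuous_const.add continuous_id)).intervalIntegrable 0 s
  have I2 : IntervalIntegrable (fun _ => deriv X τ₀) volume 0 s := continuous_const.intervalIntegrable 0 s
  rw [intervalIntegral.integral_sub I1 I2, intervalIntegral.integral_comp_add_left (fun u => deriv X u) τ₀,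
    intervalIntegral.integral_deriv_eq_sub (fun x _ => hd x) (hc.intervalIntegrable _ _), intervalIntegral.integral_const]
  simp only [add_zero, sub_zero]

/-! ## §1 Near-straight geometry of a unit-speed curve -/

/-- Unit tangents with oscillation `≤ ε` stay aligned: `1 − ε²/2 ≤ ⟪X′ r, X′ s⟫`. [folklore] -/
theorem inner_deriv_deriv_ge_of_osc {E : Type*} [NormedAddCommGroup E] [InnerProductSpace ℝ E] {X : ℝ → E}
    (hunit : ∀ s, ‖deriv X s‖ = 1) {ε : ℝ} (hosc : ∀ u v, ‖deriv X u - deriv X v‖ ≤ ε) (r s : ℝ) :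
    1 - ε ^ 2 / 2 ≤ ⟪deriv X r, deriv X s⟫ := by
  have h1 := hosc r s
  have hε : 0 ≤ ε := le_trans (norm_nonneg _) h1
  have h2 : ‖deriv X r - deriv X s‖ ^ 2 = 2 - 2 * ⟪deriv X r, deriv X s⟫ := by
    rw [← real_inner_self_eq_norm_sq, inner_sub_left, inner_sub_right, inner_sub_right,
      real_inner_self_eq_norm_sq, real_inner_self_eq_norm_sq, hunit r, hunit s, real_inner_comm (deriv X s)]
    ring
  have h3 : ‖deriv X r - deriv X s‖ ^ 2 ≤ ε ^ 2 := pow_le_pow_left₀ (norm_nonneg _) h1 2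
  linarith

/-- Chords project far along EVERY tangent: `(1 − ε²/2)(u − t) ≤ ⟪X u − X t, X′ s⟫` for `t ≤ u`. [folklore] -/
theorem inner_chord_deriv_ge_of_osc {E : Type*} [NormedAddCommGroup E] [InnerProductSpace ℝ E] [CompleteSpace E]
    {X : ℝ → E} (hX : ContDiff ℝ 1 X) (hunit : ∀ s, ‖deriv X s‖ = 1) {ε : ℝ}
    (hosc : ∀ u v, ‖deriv X u - deriv X v‖ ≤ ε) {t u : ℝ} (htu : t ≤ u) (s : ℝ) :
    (1 - ε ^ 2 / 2) * (u - t) ≤ ⟪X u - X t, deriv X s⟫ := by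
  have hd : Differentiable ℝ X := hX.differentiable one_ne_zero
  have hc : Continuous (deriv X) := hX.continuous_deriv le_rfl
  have hftc : X u - X t = ∫ r in t..u, deriv X r :=
    (integral_deriv_eq_sub (fun x _ => hd x) (hc.intervalIntegrable _ _)).symm
  have hinner : ⟪∫ r in t..u, deriv X r, deriv X s⟫ = ∫ r in t..u, ⟪deriv X s, deriv X r⟫ := by
    rw [real_inner_comm, intervalIntegral.integral_of_le htu, intervalIntegral.integral_of_le htu,
      ← integral_inner ((hc.integrableOn_Icc).mono_set Set.Ioc_subset_Icc_self)]
  rw [hftc, hinner]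
  have hmin : ∫ _ in t..u, (1 - ε ^ 2 / 2) ≤ ∫ r in t..u, ⟪deriv X s, deriv X r⟫ := by
    refine integral_mono_on htu (continuous_const.intervalIntegrable _ _)
      ((continuous_const.inner hc).intervalIntegrable _ _) fun r _ => ?_
    exact inner_deriv_deriv_ge_of_osc hunit hosc s r
  rw [intervalIntegral.integral_const, smul_eq_mul] at hmin
  linarith

/-- GLOBAL CHORD–ARC from tangent oscillation: `(1 − ε²/2)|u − t| ≤ ‖X u − X t‖`. [folklore] -/
theorem chord_arc_of_osc {E : Type*} [NormedAddCommGroup E] [InnerProductSpace ℝ E] [CompleteSpace E]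
    {X : ℝ → E} (hX : ContDiff ℝ 1 X) (hunit : ∀ s, ‖deriv X s‖ = 1) {ε : ℝ}
    (hosc : ∀ u v, ‖deriv X u - deriv X v‖ ≤ ε) (u t : ℝ) :
    (1 - ε ^ 2 / 2) * |u - t| ≤ ‖X u - X t‖ := by
  wlog htu : t ≤ u generalizing u t
  · have := this t u (le_of_not_ge htu)
    rwa [abs_sub_comm, norm_sub_rev] at this
  have h1 := inner_chord_deriv_ge_of_osc hX hunit hosc htu t
  have h2 : ⟪X u - X t, deriv X t⟫ ≤ ‖X u - X t‖ := by simpa [hunit t] using real_inner_le_norm (X u - X t) (deriv X t)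
  rw [abs_of_nonneg (sub_nonneg.2 htu)]
  linarith

/-- The chord is `ε|u − t|`-close to `(u − t) • X′ s` for EVERY `s`: `‖X u − X t − (u − t) • X′ s‖ ≤ ε|u − t|`. [folklore] -/
theorem norm_chord_sub_smul_deriv_le_of_osc {E : Type*} [NormedAddCommGroup E] [NormedSpace ℝ E] [CompleteSpace E]
    {X : ℝ → E} (hX : ContDiff ℝ 1 X) {ε : ℝ} (hosc : ∀ u v, ‖deriv X u - deriv X v‖ ≤ ε) (u t s : ℝ) :
    ‖X u - X t - (u - t) • deriv X s‖ ≤ ε * |u - t| := by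
  have hd : Differentiable ℝ X := hX.differentiable one_ne_zero
  have hc : Continuous (deriv X) := hX.continuous_deriv le_rfl
  have hftc : X u - X t = ∫ r in t..u, deriv X r :=
    (integral_deriv_eq_sub (fun x _ => hd x) (hc.intervalIntegrable _ _)).symm
  have hcs : (u - t) • deriv X s = ∫ _ in t..u, deriv X s := by rw [intervalIntegral.integral_const]
  have I1 : IntervalIntegrable (fun r => deriv X r) volume t u := hc.intervalIntegrable _ _
  have I2 : IntervalIntegrable (fun _ => deriv X s) volume t u := continuous_const.intervalIntegrable _ _
  rw [hftc, hcs, ← intervalIntegral.integral_sub I1 I2]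
  have := intervalIntegral.norm_integral_le_of_norm_le_const (a := t) (b := u) (C := ε)
    (f := fun r => deriv X r - deriv X s) fun r _ => hosc r s
  simpa [abs_sub_comm] using this

/-- Second-order Taylor remainder from a curvature bound: `‖X(τ + h) − X τ − h • X′ τ‖ ≤ κ₀ h²` when `‖X″‖ ≤ κ₀`. [folklore] -/
theorem norm_taylor_two_le {E : Type*} [NormedAddCommGroup E] [NormedSpace ℝ E] [CompleteSpace E]
    {X : ℝ → E} (hX : ContDiff ℝ 2 X) {κ₀ : ℝ} (hκ : ∀ s, ‖deriv (deriv X) s‖ ≤ κ₀) (τ h : ℝ) :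
    ‖X (τ + h) - X τ - h • deriv X τ‖ ≤ κ₀ * h ^ 2 := by
  rw [sjt_pos_sub_eq_integral hX τ h]
  have hb : ∀ u ∈ Set.uIoc (0:ℝ) h, ‖deriv X (τ + u) - deriv X τ‖ ≤ κ₀ * |h| := by
    intro u hu
    have h1 := sjt_norm_deriv_sub_deriv_le hX hκ (τ + u) τ
    have h2 : |τ + u - τ| = |u| := by ring_nf
    rw [h2] at h1
    have hκ0 : 0 ≤ κ₀ := le_trans (norm_nonneg _) (hκ 0)
    have h3 : |u| ≤ |h| := by
      rcases Set.mem_uIoc.1 hu with ⟨ha, hb⟩ | ⟨ha, hb⟩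
      · rw [abs_of_pos ha]; exact le_trans hb (le_abs_self h)
      · rw [abs_of_nonpos hb, abs_of_neg (lt_of_lt_of_le ha hb)]; linarith
    exact h1.trans (mul_le_mul_of_nonneg_left h3 hκ0)
  have := intervalIntegral.norm_integral_le_of_norm_le_const hb
  calc ‖∫ u in (0:ℝ)..h, deriv X (τ + u) - deriv X τ‖ ≤ κ₀ * |h| * |h - 0| := this
    _ = κ₀ * h ^ 2 := by rw [sub_zero, mul_assoc, abs_mul_abs_self, sq]

/-! ## §2 The self strand: tangential component of the self-induction integrand -/

/-- The `c ∧ c` cancellation in coordinates: `⟪a × D, T⟫ = ⟪(a − T) × (D + h • T), T⟫` for every `h`. [folklore] -/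
private theorem inner_cross_eq_inner_cross_sub_add (a D T : EuclideanSpace ℝ (Fin 3)) (h : ℝ) :
    ⟪cross a D, T⟫ = ⟪cross (a - T) (D + h • T), T⟫ := by
  simp only [real_inner_fin3, cross_apply_zero, cross_apply_one, cross_apply_two, PiLp.add_apply,
    PiLp.sub_apply, PiLp.smul_apply, smul_eq_mul]
  ring

/-- The regularised kernel is below the bare cube: `((r² + e²)^{3/2})⁻¹ ≤ (r³)⁻¹` for `0 < r`. [folklore] -/
private theorem kernel_le_inv_cube {r : ℝ} (hr : 0 < r) (e : ℝ) : ((r ^ 2 + e ^ 2) ^ (3 / 2 : ℝ))⁻¹ ≤ (r ^ 3)⁻¹ := by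
  have h1 : r ^ 3 = (r ^ 2) ^ (3 / 2 : ℝ) := by
    rw [show r ^ 2 = r ^ (2:ℝ) by norm_cast, ← Real.rpow_mul hr.le]
    norm_num
  rw [h1]
  have h2 : (r ^ 2) ^ (3 / 2 : ℝ) ≤ (r ^ 2 + e ^ 2) ^ (3 / 2 : ℝ) :=
    Real.rpow_le_rpow (by positivity) (by nlinarith [sq_nonneg e]) (by norm_num)
  exact inv_anti₀ (Real.rpow_pos_of_pos (by positivity) _) h2

/-- **Pointwise tangential bound on the self strand.**  For a `C²` unit-speed curve with `‖X″‖ ≤ κ₀` and global chord–arc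
constant `c ∈ (0,1]`, the tangential component of the regularised self-induction integrand at `X τ` satisfies
`|⟪K(σ) • X′σ × (Xτ − Xσ), X′τ⟫| ≤ (2κ₀²/c³)·(1 + (κ₀(σ − τ))²)⁻¹`. [folklore] -/
theorem abs_inner_selfKernel_le {X : ℝ → EuclideanSpace ℝ (Fin 3)} (hX : ContDiff ℝ 2 X) (hunit : ∀ s, ‖deriv X s‖ = 1)
    {κ₀ c : ℝ} (hκ : ∀ s, ‖deriv (deriv X) s‖ ≤ κ₀) (hc : 0 < c) (hc1 : c ≤ 1)
    (hchord : ∀ u t, c * |u - t| ≤ ‖X u - X t‖) (e τ σ : ℝ) :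
    |⟪((‖X τ - X σ‖ ^ 2 + e ^ 2) ^ (3 / 2 : ℝ))⁻¹ • cross (deriv X σ) (X τ - X σ), deriv X τ⟫| ≤
      2 * κ₀ ^ 2 / c ^ 3 * (1 + (κ₀ * (σ - τ)) ^ 2)⁻¹ := by
  set D := X τ - X σ with hD
  set T := deriv X τ with hT
  set h := σ - τ with hh
  set k := ((‖D‖ ^ 2 + e ^ 2) ^ (3 / 2 : ℝ))⁻¹ with hk
  have hκ0 : 0 ≤ κ₀ := le_trans (norm_nonneg _) (hκ 0)
  have hk0 : 0 ≤ k := inv_nonneg.2 (Real.rpow_nonneg (by positivity) _)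
  have hq : 0 < 1 + (κ₀ * (σ - τ)) ^ 2 := by positivity
  -- the degenerate point σ = τ
  by_cases hσ : σ = τ
  · have : D = 0 := by rw [hD, hσ, sub_self]
    rw [this]
    simp only [inner_smul_left, RCLike.conj_to_real]
    have : cross (deriv X σ) (0 : EuclideanSpace ℝ (Fin 3)) = 0 := by
      have := cross_smul_right 0 (deriv X σ) (0 : EuclideanSpace ℝ (Fin 3))
      simpa using this
    rw [this, inner_zero_left, mul_zero, abs_zero]
    positivity
  have hh0 : h ≠ 0 := sub_ne_zero.2 hσ
  have hha : 0 < |h| := abs_pos.2 hh0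
  -- chord–arc at (τ, σ)
  have hDge : c * |h| ≤ ‖D‖ := by
    have := hchord τ σ
    rwa [abs_sub_comm] at this
  have hDpos : 0 < ‖D‖ := lt_of_lt_of_le (mul_pos hc hha) hDge
  have hkD : k ≤ (‖D‖ ^ 3)⁻¹ := kernel_le_inv_cube hDpos e
  -- |⟪k • a × D, T⟫| = k |⟪a × D, T⟫|
  have hsplit : |⟪k • cross (deriv X σ) D, T⟫| = k * |⟪cross (deriv X σ) D, T⟫| := by
    rw [inner_smul_left, RCLike.conj_to_real, abs_mul, abs_of_nonneg hk0]
  -- regime A: second-order structure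
  have hA : |⟪cross (deriv X σ) D, T⟫| ≤ κ₀ ^ 2 * |h| ^ 3 := by
    rw [inner_cross_eq_inner_cross_sub_add (deriv X σ) D T h]
    have h1 : ‖deriv X σ - T‖ ≤ κ₀ * |h| := by
      rw [hT, hh]; exact sjt_norm_deriv_sub_deriv_le hX hκ σ τ
    have h2 : ‖D + h • T‖ ≤ κ₀ * h ^ 2 := by
      have := norm_taylor_two_le hX hκ τ h
      have hστ : τ + h = σ := by rw [hh]; ring
      rw [hστ] at this
      have : D + h • T = -(X σ - X τ - h • deriv X τ) := by rw [hD, hT]; abel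
      rw [this, norm_neg]; assumption
    calc |⟪cross (deriv X σ - T) (D + h • T), T⟫| ≤ ‖deriv X σ - T‖ * ‖D + h • T‖ * ‖T‖ := sjt_abs_triple_le _ _ _
      _ ≤ κ₀ * |h| * (κ₀ * h ^ 2) * 1 := by
          rw [hT, hunit τ]
          gcongr
      _ = κ₀ ^ 2 * |h| ^ 3 := by
          rw [show h ^ 2 = |h| ^ 2 by rw [sq_abs]]; ring
  -- regime B: trivial
  have hB : |⟪cross (deriv X σ) D, T⟫| ≤ ‖D‖ := by
    calc |⟪cross (deriv X σ) D, T⟫| ≤ ‖deriv X σ‖ * ‖D‖ * ‖T‖ := sjt_abs_triple_le _ _ _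
      _ = ‖D‖ := by rw [hunit σ, hT, hunit τ, one_mul, mul_one]
  -- the two bounds on k |⟪…⟫|
  have hc3 : 0 < c ^ 3 := pow_pos hc 3
  have hDcube : 0 < ‖D‖ ^ 3 := pow_pos hDpos 3
  have hboundA : k * |⟪cross (deriv X σ) D, T⟫| ≤ κ₀ ^ 2 / c ^ 3 := by
    calc k * |⟪cross (deriv X σ) D, T⟫| ≤ (‖D‖ ^ 3)⁻¹ * (κ₀ ^ 2 * |h| ^ 3) :=
          mul_le_mul hkD hA (abs_nonneg _) (inv_nonneg.2 hDcube.le)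
      _ ≤ ((c * |h|) ^ 3)⁻¹ * (κ₀ ^ 2 * |h| ^ 3) := by
          gcongr
      _ = κ₀ ^ 2 / c ^ 3 := by
          field_simp
  have hboundB : k * |⟪cross (deriv X σ) D, T⟫| ≤ (c ^ 2 * h ^ 2)⁻¹ := by
    calc k * |⟪cross (deriv X σ) D, T⟫| ≤ (‖D‖ ^ 3)⁻¹ * ‖D‖ :=
          mul_le_mul hkD hB (abs_nonneg _) (inv_nonneg.2 hDcube.le)
      _ = (‖D‖ ^ 2)⁻¹ := by field_simp
      _ ≤ ((c * |h|) ^ 2)⁻¹ := by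
          gcongr
      _ = (c ^ 2 * h ^ 2)⁻¹ := by rw [mul_pow, sq_abs]
  -- combine: k|…|·(1 + κ₀²h²) ≤ κ₀²/c³ + κ₀²/c² ≤ 2κ₀²/c³
  rw [hsplit]
  have hq' : 0 < 1 + (κ₀ * h) ^ 2 := by positivity
  rw [← div_eq_mul_inv, le_div_iff₀ hq', mul_add, mul_one, show 2 * κ₀ ^ 2 / c ^ 3 = 2 * (κ₀ ^ 2 / c ^ 3) by ring]
  have hsecond : k * |⟪cross (deriv X σ) D, T⟫| * (κ₀ * h) ^ 2 ≤ κ₀ ^ 2 / c ^ 2 := by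
    have h2pos : 0 < c ^ 2 * h ^ 2 := by positivity
    calc k * |⟪cross (deriv X σ) D, T⟫| * (κ₀ * h) ^ 2 ≤ (c ^ 2 * h ^ 2)⁻¹ * (κ₀ * h) ^ 2 :=
          mul_le_mul_of_nonneg_right hboundB (sq_nonneg _)
      _ = κ₀ ^ 2 / c ^ 2 := by field_simp
  have hthird : κ₀ ^ 2 / c ^ 2 ≤ κ₀ ^ 2 / c ^ 3 :=
    div_le_div_of_nonneg_left (sq_nonneg _) hc3 (by nlinarith [pow_pos hc 2])
  linarith

/-- **Self-strand tangential bound.**  For a `C²` unit-speed curve `X` with `‖X″‖ ≤ κ₀` (`0 < κ₀`), global chord–arc constant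
`c ∈ (0,1]` and any core parameter `e ≠ 0`, the tangential component of the regularised self-induced velocity at `X τ` obeys
`|⟪∫ ((‖Xτ − Xσ‖² + e²)^{3/2})⁻¹ • X′σ × (Xτ − Xσ) dσ, X′τ⟫| ≤ 2πκ₀/c³`, uniformly in `τ` and `e`. [folklore] -/
theorem abs_inner_selfInduction_le {X : ℝ → EuclideanSpace ℝ (Fin 3)} (hX : ContDiff ℝ 2 X) (hunit : ∀ s, ‖deriv X s‖ = 1)
    {κ₀ c e : ℝ} (hκ₀ : 0 < κ₀) (hκ : ∀ s, ‖deriv (deriv X) s‖ ≤ κ₀) (hc : 0 < c) (hc1 : c ≤ 1)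
    (hchord : ∀ u t, c * |u - t| ≤ ‖X u - X t‖) (he : e ≠ 0) (τ : ℝ) :
    |⟪∫ σ : ℝ, ((‖X τ - X σ‖ ^ 2 + e ^ 2) ^ (3 / 2 : ℝ))⁻¹ • cross (deriv X σ) (X τ - X σ), deriv X τ⟫| ≤
      2 * Real.pi * κ₀ / c ^ 3 := by
  -- integrability (landed brick `stub_kernelIntegrable`, growth from chord–arc at 0)
  have hgrow : ∀ u, c * |u| - ‖X 0‖ ≤ ‖X u‖ := by
    intro u
    have h1 := hchord u 0
    rw [sub_zero] at h1
    have h2 : ‖X u - X 0‖ ≤ ‖X u‖ + ‖X 0‖ := norm_sub_le _ _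
    linarith
  have hint : Integrable (fun σ : ℝ =>
      ((‖X τ - X σ‖ ^ 2 + e ^ 2) ^ (3 / 2 : ℝ))⁻¹ • cross (deriv X σ) (X τ - X σ)) :=
    stub_kernelIntegrable e c ‖X 0‖ X he hc (hX.of_le (by norm_num)) (fun u => (hunit u).le) hgrow (X τ)
  rw [real_inner_comm, ← integral_inner hint]
  -- majorant
  have hM_int : Integrable (fun σ : ℝ => 2 * κ₀ ^ 2 / c ^ 3 * (1 + (κ₀ * (σ - τ)) ^ 2)⁻¹) := by
    have h1 : Integrable (fun y : ℝ => (1 + (y - κ₀ * τ) ^ 2)⁻¹) :=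
      integrable_inv_one_add_sq.comp_sub_right (κ₀ * τ)
    have h2 : Integrable (fun σ : ℝ => (1 + (κ₀ * σ - κ₀ * τ) ^ 2)⁻¹) := h1.comp_mul_left' hκ₀.ne'
    have h3 : (fun σ : ℝ => 2 * κ₀ ^ 2 / c ^ 3 * (1 + (κ₀ * (σ - τ)) ^ 2)⁻¹) =
        fun σ : ℝ => 2 * κ₀ ^ 2 / c ^ 3 * (1 + (κ₀ * σ - κ₀ * τ) ^ 2)⁻¹ := by
      funext σ; rw [mul_sub]
    rw [h3]; exact h2.const_mul _
  have hM_val : ∫ σ : ℝ, 2 * κ₀ ^ 2 / c ^ 3 * (1 + (κ₀ * (σ - τ)) ^ 2)⁻¹ = 2 * Real.pi * κ₀ / c ^ 3 := by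
    have h3 : (fun σ : ℝ => 2 * κ₀ ^ 2 / c ^ 3 * (1 + (κ₀ * (σ - τ)) ^ 2)⁻¹) =
        fun σ : ℝ => 2 * κ₀ ^ 2 / c ^ 3 * ((fun y : ℝ => (1 + (y - κ₀ * τ) ^ 2)⁻¹) (κ₀ * σ)) := by
      funext σ; simp only [mul_sub]
    rw [h3, MeasureTheory.integral_const_mul, Measure.integral_comp_mul_left (fun y : ℝ => (1 + (y - κ₀ * τ) ^ 2)⁻¹) κ₀]
    rw [integral_sub_right_eq_self (fun y : ℝ => (1 + y ^ 2)⁻¹) (κ₀ * τ), integral_univ_inv_one_add_sq,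
      smul_eq_mul, abs_of_pos (inv_pos.2 hκ₀)]
    field_simp
  have hbound := fun σ => abs_inner_selfKernel_le hX hunit hκ hc hc1 hchord e τ σ
  have key : ‖∫ σ : ℝ, ⟪deriv X τ, ((‖X τ - X σ‖ ^ 2 + e ^ 2) ^ (3 / 2 : ℝ))⁻¹ • cross (deriv X σ) (X τ - X σ)⟫‖ ≤
      ∫ σ : ℝ, 2 * κ₀ ^ 2 / c ^ 3 * (1 + (κ₀ * (σ - τ)) ^ 2)⁻¹ :=
    norm_integral_le_of_norm_le hM_int (Eventually.of_forall fun σ => by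
      rw [Real.norm_eq_abs, real_inner_comm]; exact hbound σ)
  rw [Real.norm_eq_abs, hM_val] at key
  exact key

end Summit.NavierStokesRegularity.NavierStokesRegularity.Theorems.SkeletonJ1RSlipTools

end
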